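import Summits.AnomalousDissipation.AnomalousDissipation.Theorems.QuarticGate.Negative.EnergyRow

/-!
# Sketch — crux-ideate stmt-AnomalousDissipation-14283 (`GalerkinInvariantLoud`), round 1, ideator 3 (gen 2)

First lemmas (signatures only; proofs are NOT part of this stage) of two crux ideas:

* `zero-noise-physical-measure` — §A: `absorbed_of_isInvariant` (the support clause is free for
  all-order stationary laws with finite second moment: generalises Disproof §3 from bounded support
  to no support hypothesis), `zeroNoise_limit_step` (asymptotically stationary all-moment level-`N`
  laws converge to crux-shaped invariant laws with the same budgets), `ZeroNoiseLoud` (C⁺_A, abstract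
  form) and `gil_of_zeroNoiseLoud`.
* `wattmeter-probe-force` — §B: `work_split` (dissipation = large-scale work + probe work) and
  `probe_budget` (row of the quadratic observable `½(u,g)²` for a Stokes-eigenfield probe `g`
  orthogonal to the rest of the force: `a‖g‖² ∫(u,g) = νλ ∫(u,g)² − ∫(u,g)·∫(u⊗u):∇g`).
-/

set_option linter.dupNamespace false

namespace Summit.AnomalousDissipation.AnomalousDissipation.Cruxes.GalerkinInvariantLoud.Ideator3g2

open MeasureTheory Filter Topology
open scoped ENNReal InnerProductSpace RealInnerProductSpace
open Literature.Analysis.FunctionSpaces Literature.Analysis.FluidPDE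
open Summit.AnomalousDissipation.AnomalousDissipation.Theses.MomentParity
open Summit.AnomalousDissipation.AnomalousDissipation.Theorems.QuarticGate.Negative

noncomputable section

/-- The torus `T³`. -/
abbrev T3 : Type := UnitAddTorus (Fin 3)
/-- Velocity values. -/
abbrev R3 : Type := EuclideanSpace ℝ (Fin 3)
/-- The energy space `H = L²_σ(T³)` (mean-zero solenoidal `L²` classes). -/
abbrev H3 : Type := ↥(Torus.energySpace (Fin 3))

/-! ## §0 Vocabulary (verbatim clauses of the crux; = Disproof.lean §0) -/

/-- ALL-ORDER polynomial stationarity of `μ` for Galerkin NS at `(ν, f)`, level `N`. -/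
def IsInvariant (ν : ℝ) (f : T3 → R3) (N : ℕ) (μ : Measure H3) : Prop :=
  ∀ (m : ℕ) (g : Fin m → T3 → R3) (P : MvPolynomial (Fin m) ℝ), (∀ i, IsBandTest N (g i)) →
    Integrable (fun u => Torus.nsGeneratorPairing ν f u (polyGrad g P u)) μ ∧
      ∫ u, Torus.nsGeneratorPairing ν f u (polyGrad g P u) ∂μ = 0

/-- The witness clauses of `GalerkinInvariantLoud` at `(f, ν, N, R, E, ε)`. -/
def IsGILWitness (f : T3 → R3) (ν : ℝ) (N : ℕ) (R E ε : ℝ) (μ : Measure H3) : Prop :=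
  IsProbabilityMeasure μ ∧ (∀ᵐ u ∂μ, IsLevel N u) ∧ (∀ᵐ u ∂μ, ‖u‖ ≤ R) ∧ IsInvariant ν f N μ ∧
    Torus.ensembleEnergy μ ≤ E ∧ ε ≤ Torus.ensembleDissipation ν μ

/-- Readback: the crux through the vocabulary (definitional unfolding). -/
theorem galerkinInvariantLoud_iff :
    GalerkinInvariantLoud ↔ ∃ f : T3 → R3, Torus.IsSmooth f ∧ Torus.IsDivFree f ∧ Torus.HasZeroMean f ∧
      ∃ (ν : ℕ → ℝ) (E ε : ℝ), (∀ j, 0 < ν j) ∧ Tendsto ν atTop (𝓝 0) ∧ 0 < ε ∧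
      ∀ j : ℕ, ∃ R : ℝ, ∃ᶠ N in atTop, ∃ μ, IsGILWitness f (ν j) N R E ε μ :=
  Iff.rfl

/-! ## §A `zero-noise-physical-measure` -/

/-- **Support is free** (generalises Disproof §3 `ae_norm_le_absorbing`: NO bounded-support
hypothesis). A level-`N` carried probability law with finite second moment that is all-order
polynomially stationary is carried by the absorbing ball `‖u‖ ≤ ‖f‖₂/(4π²ν)`. (Same proof: the rows
of `(Σᵢ(u,gᵢ)²)^(n+1)` — whose integrability `IsInvariant` itself asserts — give
`aⁿ c_a μ(‖u‖ ≥ a) ≤ bⁿ ∫|I|` for `ρ < b < a`, `I = ν‖∇u‖² − (u,f)`.) So zero-noise limits, which are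
never compactly supported before the limit, land inside the crux's support clause automatically. -/
theorem absorbed_of_isInvariant {ν : ℝ} (hν : 0 < ν) {f : T3 → R3} (hf : MemLp f 2 volume)
    {N : ℕ} {μ : Measure H3} [IsProbabilityMeasure μ]
    (hlev : ∀ᵐ u ∂μ, IsLevel N u) (h2 : Integrable (fun u : H3 => ‖u‖ ^ 2) μ)
    (hinv : IsInvariant ν f N μ) :
    ∀ᵐ u ∂μ, ‖u‖ ≤ ‖hf.toLp f‖ / (4 * Real.pi ^ 2 * ν) := by
  sorry

/-- **ZERO-NOISE LIMIT STEP** (closure of the crux's clauses under asymptotically stationary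
all-moment limits). Fix `(ν, f, N)`. Let `μₙ` be level-`N` carried probability laws with uniformly
bounded moments of every order whose polynomial rows tend to `0` (for the unique stationary law of
Galerkin NS + `σₙ`·(additive noise on a finite mode set `K`) the row of `p` equals
`−(σₙ²/2) ∫ Δ_K p dμₙ → 0`), converging to `μ` on bounded continuous observables. Then `μ` is level-`N`
carried and all-order stationary, and mean energy and mean dissipation pass to the limit (on the
closed set of level-`N` fields both are continuous polynomials of quadratic growth). -/
theorem zeroNoise_limit_step {ν : ℝ} (hν : 0 < ν) {f : T3 → R3} (hfs : Torus.IsSmooth f) {N : ℕ}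
    (μs : ℕ → Measure H3) (μ : Measure H3) [∀ n, IsProbabilityMeasure (μs n)] [IsProbabilityMeasure μ]
    (hlev : ∀ n, ∀ᵐ u ∂(μs n), IsLevel N u)
    (hmom : ∀ p : ℕ, ∃ C : ℝ, ∀ n, ∫ u, ‖u‖ ^ p ∂(μs n) ≤ C)
    (hrow : ∀ (m : ℕ) (g : Fin m → T3 → R3) (P : MvPolynomial (Fin m) ℝ), (∀ i, IsBandTest N (g i)) →
      (∀ n, Integrable (fun u => Torus.nsGeneratorPairing ν f u (polyGrad g P u)) (μs n)) ∧
        Tendsto (fun n => ∫ u, Torus.nsGeneratorPairing ν f u (polyGrad g P u) ∂(μs n)) atTop (𝓝 0))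
    (hlim : ∀ Ψ : H3 → ℝ, Continuous Ψ → Bornology.IsBounded (Set.range Ψ) →
      Tendsto (fun n => ∫ u, Ψ u ∂(μs n)) atTop (𝓝 (∫ u, Ψ u ∂μ))) :
    (∀ᵐ u ∂μ, IsLevel N u) ∧ IsInvariant ν f N μ ∧
      Tendsto (fun n => Torus.ensembleEnergy (μs n)) atTop (𝓝 (Torus.ensembleEnergy μ)) ∧
        Tendsto (fun n => Torus.ensembleDissipation ν (μs n)) atTop
          (𝓝 (Torus.ensembleDissipation ν μ)) := by
  sorry

/-- **C⁺_A (abstract form of `ZeroNoiseLoud`)**: for some admissible force, along `ν_j → 0` and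
`N`-frequently, there is an asymptotically stationary all-moment level-`N` family (the stationary laws
of hypoelliptically perturbed Galerkin NS as the noise amplitude `σ → 0`) with mean energy `≤ E` and
mean WORK `∫(u,f) ≥ ε`, converging on bounded continuous observables. -/
def ZeroNoiseLoud : Prop :=
  ∃ f : T3 → R3, Torus.IsSmooth f ∧ Torus.IsDivFree f ∧ Torus.HasZeroMean f ∧
    ∃ (ν : ℕ → ℝ) (E ε : ℝ), (∀ j, 0 < ν j) ∧ Tendsto ν atTop (𝓝 0) ∧ 0 < ε ∧
    ∀ j : ℕ, ∃ᶠ N in atTop, ∃ (μs : ℕ → Measure H3) (μ : Measure H3),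
      (∀ n, IsProbabilityMeasure (μs n)) ∧ IsProbabilityMeasure μ ∧
      (∀ n, ∀ᵐ u ∂(μs n), IsLevel N u) ∧
      (∀ p : ℕ, ∃ C : ℝ, ∀ n, ∫ u, ‖u‖ ^ p ∂(μs n) ≤ C) ∧
      (∀ (m : ℕ) (g : Fin m → T3 → R3) (P : MvPolynomial (Fin m) ℝ), (∀ i, IsBandTest N (g i)) →
        (∀ n, Integrable (fun u => Torus.nsGeneratorPairing (ν j) f u (polyGrad g P u)) (μs n)) ∧
          Tendsto (fun n => ∫ u, Torus.nsGeneratorPairing (ν j) f u (polyGrad g P u) ∂(μs n))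
            atTop (𝓝 0)) ∧
      (∀ Ψ : H3 → ℝ, Continuous Ψ → Bornology.IsBounded (Set.range Ψ) →
        Tendsto (fun n => ∫ u, Ψ u ∂(μs n)) atTop (𝓝 (∫ u, Ψ u ∂μ))) ∧
      (∀ n, Torus.ensembleEnergy (μs n) ≤ E) ∧ (∀ n, ε ≤ ∫ u, Torus.pairing u.1 f ∂(μs n))

/-- **Glue A**: `ZeroNoiseLoud → GalerkinInvariantLoud` (limit step + support-is-free + energy row
`dissipation = work` for the invariant limit, `ensembleDissipation_eq_of_polyStationary`). -/
theorem gil_of_zeroNoiseLoud : ZeroNoiseLoud → GalerkinInvariantLoud := by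
  sorry

/-! ## §B `wattmeter-probe-force` -/

/-- **Work split**: for an all-order stationary level-`N` law under the composite force `f_L + a•g`,
`ν∫‖∇u‖² = ∫(u,f_L) + a∫(u,g)` (energy row `dissipation_eq` + linearity of the pairing). -/
theorem work_split {ν : ℝ} {fL g : T3 → R3} (hfL : Torus.IsSmooth fL) (hg : Torus.IsSmooth g) (a : ℝ)
    {N : ℕ} {μ : Measure H3} [IsProbabilityMeasure μ] (hlev : ∀ᵐ u ∂μ, IsLevel N u)
    (h2 : Integrable (fun u : H3 => ‖u‖ ^ 2) μ) (hinv : IsInvariant ν (fL + a • g) N μ) :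
    Torus.ensembleDissipation ν μ =
      (∫ u, Torus.pairing u.1 fL ∂μ) + a * ∫ u, Torus.pairing u.1 g ∂μ := by
  sorry

/-- **Probe budget** (row of `½(u,g)²`, i.e. `m = 1`, `g₀ = g`, `P = ½X₀²`): if the probe `g` is a
band-limited Stokes eigenfield (`Δg = −λg`) orthogonal to the rest of the force, then
`a‖g‖₂² ∫(u,g)dμ = νλ ∫(u,g)²dμ − ∫ (u,g)·(∫(u⊗u):∇g) dμ`: the PROBE WORK `a∫(u,g)` equals the net
nonlinear transfer out of the probe direction plus its own viscous loss — in particular it is a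
statistic of the probe coordinate alone, accessible to linear-response analysis when `a` is small. -/
theorem probe_budget {ν a lam : ℝ} {fL g : T3 → R3} {N : ℕ} (hg : IsBandTest N g)
    (hlap : Torus.laplacian g = -(lam • g)) (horth : ∫ x, ⟪fL x, g x⟫_ℝ = 0)
    (hfL : Torus.IsSmooth fL) {μ : Measure H3} [IsProbabilityMeasure μ]
    (hlev : ∀ᵐ u ∂μ, IsLevel N u) (h4 : Integrable (fun u : H3 => ‖u‖ ^ 4) μ)
    (hinv : IsInvariant ν (fL + a • g) N μ) :
    a * (∫ x, ‖g x‖ ^ 2) * ∫ u, Torus.pairing u.1 g ∂μ =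
      ν * lam * ∫ u, (Torus.pairing u.1 g) ^ 2 ∂μ -
        ∫ u, Torus.pairing u.1 g * Torus.inertialPairing u.1 g ∂μ := by
  sorry

end

end Summit.AnomalousDissipation.AnomalousDissipation.Cruxes.GalerkinInvariantLoud.Ideator3g2
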